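import Summits.ResolutionOfSingularities.ResolutionOfSingularities.Theorems.FrobeniusClosingSteerStrippedChainParity
import Summits.ResolutionOfSingularities.ResolutionOfSingularities.Theorems.FrobeniusClosingSteerCleaningOptimalOfIsolated
import HarnessLib

/-!
# Crux `Steer` (stmt-ResolutionOfSingularities-16345), chain W4.1, p = 2 T-line, F-A3(3): the PARITY LAW over the quadratic-transform
# binders alone (the regular-parameter hypotheses discharged)

OURS (campaign `res-hironaka`, rung L ★L-G4, slot W4.1; seat res-L0-w41-stub-2 g5, U8b; replaces the role of no printed item; NOT a statement of
the manuscript under review; AI-produced, weaker than expert review). `RadicandChain.cleaner_sub_pow_not_mem_pow_succ` (p525525) kept the two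
hypotheses `x m ∈ 𝔪_{m+1}` and `x m ∉ 𝔪_{m+1}²`; res-L0-w41-plan-1 RULING 89 observed that they follow from the quadratic-transform binders of
`NoEternalStrippedRadicandChain` via res-D-pv-011's `CleaningOptimal.excParam_mem_and_not_mem_sq` (p-number in the tree; Cutkosky §2.1–2.2 + Matsumura
14.2: the exceptional parameter generates 𝔪_m S(m+1) and S(m+1)/(x m) is regular). This file is that one-line discharge:

* `RadicandChain.cleaner_sub_pow_not_mem_pow_succ_of_isQuadraticTransform` — under the VERBATIM binders of `NoEternalStrippedRadicandChain p c`
  (regular members of dimension `c ≥ 3`, `IsQuadraticTransform (S m) (S (m+1))`, the span clause, the stripped law, multiplicity `p`, isolatedness),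
  NO cleaner beats the stripping exponent: `f m − h^p ∉ 𝔪_m^(p·e m + 1)` for all `m`, `h`. At `p = 2`: every member of a stripped chain has even
  cleaned order `2·e m`.

[cite: Cutkosky2014, §2.1] [cite: Matsumura1987, Thm. 14.2 and Thm. 19.4] [folklore]
-/

noncomputable section

-- `Summit.<S>.<S>.…` duplicates the summit name by design (single-problem summit).
set_option linter.dupNamespace false

open Polynomial IsLocalRing

namespace Summit.ResolutionOfSingularities.ResolutionOfSingularities.Theorems.SwitchingDichotomy

namespace RadicandChain

open Literature.AlgebraicGeometry.Resolution

variable (p : ℕ) [hp : Fact p.Prime] {L : Type} [Field L] [CharP L p]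

/-- **PARITY LAW over the quadratic-transform binders.** Under the binders of `NoEternalStrippedRadicandChain p c` (`c ≥ 3`): for every stage `m`
and every `h ∈ S m`, `f m − h^p ∉ 𝔪_m^(p · e m + 1)`. The regular-parameter facts `x m ∈ 𝔪_{m+1} ∖ 𝔪_{m+1}²` used by
`cleaner_sub_pow_not_mem_pow_succ` are supplied by `CleaningOptimal.excParam_mem_and_not_mem_sq` from `IsQuadraticTransform (S m) (S (m+1))`
and the span clause. The excellence and `hinf` binders are not used. [cite: Cutkosky2014, §2.1] [cite: Matsumura1987, Thm. 14.2] [folklore] -/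
theorem cleaner_sub_pow_not_mem_pow_succ_of_isQuadraticTransform (S : ℕ → Subring L) [∀ m, IsLocalRing (S m)] (c : ℕ) (hc : 3 ≤ c)
    (hle : ∀ m, S m ≤ S (m + 1)) (f g : ∀ m, S m) (x : ∀ m, S (m + 1)) (e : ℕ → ℕ)
    (hreg : ∀ m, IsRegularLocalRing (S m)) (hdim : ∀ m, ringKrullDim (S m) = c)
    (hQT : ∀ m, IsQuadraticTransform (S m) (S (m + 1)))
    (hspan : ∀ m, Ideal.span ((fun y : S m => (⟨(y : L), hle m y.2⟩ : S (m + 1))) ''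
        (maximalIdeal (S m) : Set (S m))) = Ideal.span {x m})
    (hrel : ∀ m, ((f (m + 1) : S (m + 1)) : L) * ((x m : S (m + 1)) : L) ^ (p * e m) =
        ((f m : S m) : L) - ((g m : S m) : L) ^ p)
    (hmult : ∀ m, ∃ h : S m, f m - h ^ p ∈ maximalIdeal (S m) ^ p)
    (hisol : ∀ m, ∀ (Q : Ideal (AdjoinRoot ((X : (S m)[X]) ^ p - C (f m)))) [Q.IsPrime],
      (∃ Q' : Ideal (AdjoinRoot ((X : (S m)[X]) ^ p - C (f m))), Q'.IsPrime ∧ Q < Q') →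
      IsRegularLocalRing (Localization.AtPrime Q))
    (m : ℕ) (h : S m) : f m - h ^ p ∉ maximalIdeal (S m) ^ (p * e m + 1) := by
  have hx : ∀ m, x m ∈ maximalIdeal (S (m + 1)) ∧ x m ∉ maximalIdeal (S (m + 1)) ^ 2 := fun m =>
    CleaningOptimal.excParam_mem_and_not_mem_sq (hreg m) (hreg (m + 1)) (hQT m) (hle m) (x m) (hspan m)
  exact cleaner_sub_pow_not_mem_pow_succ p S c hc hle f g x e hreg hdim hspan hrel (fun m => (hx m).1) (fun m => (hx m).2)
    hmult hisol m h

end RadicandChain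

end Summit.ResolutionOfSingularities.ResolutionOfSingularities.Theorems.SwitchingDichotomy

end
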